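import Summits.AnomalousDissipation.AnomalousDissipation.Theorems.MarginalStabilityChainStrainedLayerLawSumRuleLine
import Summits.AnomalousDissipation.AnomalousDissipation.Theorems.MarginalStabilityChainStretchedVortexRowsStubRowVorticityConstructionToolsApprox

/-!
# Stub `stub_momentPairKernel` (crux stmt-AnomalousDissipation-3007, line `strain-work-sum-rule`) — tools A:
# the regularised cylinder kernels in shifted physical variables

Support file (`--supports stmt-AnomalousDissipation-3007`), first brick of the kinematic representation
`strainMoment L u v = −½ pairForm L (vorticity u v)` (stub `stub_momentPairKernel`: for one `C²`, divergence-free,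
`L`-periodic slice with the shear far field, `∫∫ yωu = −½K_L[ω]`). The whole proof (files A–E =
`…StubMomentPairKernelKernels/Strip/Green/Approx` and `…StubMomentPairKernel`) is: GREEN'S IDENTITY AT LEVEL ε
for the REGULARISED cylinder kernels of the 3009 tools (`RowBiotSavart`, namespace
`…MarginalStabilityChainStretchedVortexRows`), the tools' approximate identity `ΔΦ_ε^L` (`u_ε → u`), Fubini and
oddness on `cell × cell`, and dominated convergence `ε → 0⁺`. With `s = 2πδx/L`, `t = 2πδy/L`,
`D_ε = cosh t − cos s + ε` (`ε > 0`), this file provides: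

* `kerU = sinh t/D_ε` (`K₁^ε`), `kerV = sin s/D_ε` (`K₂^ε`), `kerUU = (cosh t·D_ε − sinh²t)/D_ε²` (`∂ₜK₁^ε`),
  `kerVV = (cos s·D_ε − sin²s)/D_ε²` (`∂ₛK₂^ε`), `kerUV = sinh t sin s/D_ε²` (`−∂ₛK₁^ε = −∂ₜK₂^ε`),
  `bump = (2π/L)² ε(cosh t + cos s)/D_ε² = ΔΦ_ε^L = (2π/L)²(kerUU + kerVV)` (the tools' approximate identity),
  and the regularised PAIR KERNEL `pairKernelReg L ε δx δy = δy sinh t/(2L D_ε)` (`= pairKernel L` at `ε = 0`);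
* their slice derivatives in the SHIFTED variables `(x − x′, y − y′)` as functions of `x′`, `y′` (`HasDerivAt`),
  oddness, `L`-periodicity, continuity, the bounds `|kerU| ≤ 2 + 2/ε`, `|kerV| ≤ 1/ε`, `|kerUV| ≤ (2 + 2/ε)/ε`,
  the exponential bounds of `kerUU`, `kerVV` (from the tools), the flux limits `kerU(x − x′, y − ·) → ∓1` at `±∞`;
* the UNIFORM PAIR-KERNEL BOUND `|pairKernelReg L ε δx δy| ≤ |δy|/(2L) + 1/(2π)` for all `ε ≥ 0`
  (from the elementary `|t| sinh|t| ≤ (|t| + 2)(cosh t − 1)`): the pair kernel has NO singularity.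
Registered sub-goal proved here: `stub_momentPairKernel_pairKernelBound`. All `[folklore]`.
-/

-- `Summit.<Summit>.<Problem>` is the tree's mandated summit-side namespace (CONVENTIONS §2); for this
-- single-conjunct summit the two coincide, so the duplicate is deliberate.
set_option linter.dupNamespace false

noncomputable section

open scoped Topology
open Filter Set Function MeasureTheory Real

namespace Summit.AnomalousDissipation.AnomalousDissipation.Theorems.StrainedLayerLaw.StrainWorkSumRule

open Summit.AnomalousDissipation.AnomalousDissipation.Theorems.MarginalStabilityChainStretchedVortexRows
open Literature.Analysis.FluidPDE Literature.Analysis.FluidPDE.StretchedLayer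

/-! ### The regularised kernels (physical variables) -/

/-- `K₁^ε(δx, δy) = sinh t/(cosh t − cos s + ε)`, `s = 2πδx/L`, `t = 2πδy/L`. [folklore] -/
def kerU (L ε δx δy : ℝ) : ℝ :=
  Real.sinh (2 * π * δy / L) / (Real.cosh (2 * π * δy / L) - Real.cos (2 * π * δx / L) + ε)

/-- `K₂^ε(δx, δy) = sin s/(cosh t − cos s + ε)`. [folklore] -/
def kerV (L ε δx δy : ℝ) : ℝ :=
  Real.sin (2 * π * δx / L) / (Real.cosh (2 * π * δy / L) - Real.cos (2 * π * δx / L) + ε)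

/-- `∂ₜK₁^ε = (cosh t·D_ε − sinh²t)/D_ε²`. [folklore] -/
def kerUU (L ε δx δy : ℝ) : ℝ :=
  (Real.cosh (2 * π * δy / L) * (Real.cosh (2 * π * δy / L) - Real.cos (2 * π * δx / L) + ε) -
      Real.sinh (2 * π * δy / L) ^ 2) /
    (Real.cosh (2 * π * δy / L) - Real.cos (2 * π * δx / L) + ε) ^ 2

/-- `∂ₛK₂^ε = (cos s·D_ε − sin²s)/D_ε²`. [folklore] -/
def kerVV (L ε δx δy : ℝ) : ℝ :=
  (Real.cos (2 * π * δx / L) * (Real.cosh (2 * π * δy / L) - Real.cos (2 * π * δx / L) + ε) -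
      Real.sin (2 * π * δx / L) ^ 2) /
    (Real.cosh (2 * π * δy / L) - Real.cos (2 * π * δx / L) + ε) ^ 2

/-- The mixed kernel `sinh t sin s/D_ε²` (`= −∂ₛK₁^ε = −∂ₜK₂^ε`). [folklore] -/
def kerUV (L ε δx δy : ℝ) : ℝ :=
  Real.sinh (2 * π * δy / L) * Real.sin (2 * π * δx / L) /
    (Real.cosh (2 * π * δy / L) - Real.cos (2 * π * δx / L) + ε) ^ 2

/-- The approximate identity `ΔΦ_ε^L = (2π/L)² ε (cosh t + cos s)/D_ε²` (the tools' bump, verbatim shape).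
[folklore] -/
def bump (L ε δx δy : ℝ) : ℝ :=
  (2 * π / L) ^ 2 * (ε * (Real.cosh (2 * π * δy / L) + Real.cos (2 * π * δx / L)) /
    (Real.cosh (2 * π * δy / L) - Real.cos (2 * π * δx / L) + ε) ^ 2)

/-- The regularised pair kernel `δy sinh t/(2L D_ε)`; at `ε = 0` it is `pairKernel L`. [folklore] -/
def pairKernelReg (L ε δx δy : ℝ) : ℝ :=
  δy * Real.sinh (2 * π * δy / L) /
    (2 * L * (Real.cosh (2 * π * δy / L) - Real.cos (2 * π * δx / L) + ε))

/-- `pairKernelReg L 0 = pairKernel L`. [folklore] -/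
theorem pairKernelReg_zero (L δx δy : ℝ) : pairKernelReg L 0 δx δy = pairKernel L δx δy := by
  simp only [pairKernelReg, pairKernel, add_zero]

/-! ### Algebra: positivity, symmetry, periodicity -/

section Algebra

variable {L ε : ℝ}

/-- `D_ε > 0`. [folklore] -/
theorem denR_pos (hε : 0 < ε) (L δx δy : ℝ) :
    0 < Real.cosh (2 * π * δy / L) - Real.cos (2 * π * δx / L) + ε :=
  RowBiotSavart.denReg_pos hε _ _

/-- `kerUV = kerU · kerV`. [folklore] -/
theorem kerUV_eq_mul (L ε δx δy : ℝ) : kerUV L ε δx δy = kerU L ε δx δy * kerV L ε δx δy := by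
  simp only [kerUV, kerU, kerV]
  rw [div_mul_div_comm, sq]

/-- `bump = (2π/L)² (kerUU + kerVV)` (the tools' `lap_logKerReg`). [folklore] -/
theorem bump_eq (hε : 0 < ε) (L δx δy : ℝ) :
    bump L ε δx δy = (2 * π / L) ^ 2 * (kerUU L ε δx δy + kerVV L ε δx δy) := by
  simp only [bump, kerUU, kerVV]
  rw [RowBiotSavart.lap_logKerReg hε]

/-- `0 ≤ bump`. [folklore] -/
theorem bump_nonneg (hε : 0 < ε) (L δx δy : ℝ) : 0 ≤ bump L ε δx δy :=
  mul_nonneg (sq_nonneg _) (RowBiotSavart.bumpReg_nonneg hε _ _)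

/-- `pairKernelReg = δy · kerU/(2L)` for `ε > 0`. [folklore] -/
theorem pairKernelReg_eq (hε : 0 < ε) (L δx δy : ℝ) :
    pairKernelReg L ε δx δy = δy * kerU L ε δx δy / (2 * L) := by
  simp only [pairKernelReg, kerU]
  have hD := (denR_pos hε L δx δy).ne'
  rcases eq_or_ne L 0 with hL | hL
  · subst hL; simp
  · field_simp

/-- `kerU` is odd under the point reflection. [folklore] -/
theorem kerU_neg_neg (L ε δx δy : ℝ) : kerU L ε (-δx) (-δy) = -kerU L ε δx δy := by
  simp only [kerU]
  rw [show 2 * π * -δy / L = -(2 * π * δy / L) by ring, show 2 * π * -δx / L = -(2 * π * δx / L) by ring,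
    Real.sinh_neg, Real.cosh_neg, Real.cos_neg, neg_div]

/-- The normalised abscissa shifts by `2π` over a period. [folklore] -/
theorem normFst_add_period (hL : L ≠ 0) (δx : ℝ) : 2 * π * (δx + L) / L = 2 * π * δx / L + 2 * π := by
  field_simp

/-- `kerU` is `L`-periodic in `δx`. [folklore] -/
theorem kerU_add_period (hL : L ≠ 0) (ε δx δy : ℝ) : kerU L ε (δx + L) δy = kerU L ε δx δy := by
  simp only [kerU]; rw [normFst_add_period hL, Real.cos_add_two_pi]

/-- `kerV` is `L`-periodic in `δx`. [folklore] -/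
theorem kerV_add_period (hL : L ≠ 0) (ε δx δy : ℝ) : kerV L ε (δx + L) δy = kerV L ε δx δy := by
  simp only [kerV]; rw [normFst_add_period hL, Real.cos_add_two_pi, Real.sin_add_two_pi]

/-- `bump` is `L`-periodic in `δx`. [folklore] -/
theorem bump_add_period (hL : L ≠ 0) (ε δx δy : ℝ) : bump L ε (δx + L) δy = bump L ε δx δy := by
  simp only [bump]; rw [normFst_add_period hL, Real.cos_add_two_pi]

/-- `pairKernelReg` is `L`-periodic in `δx`. [folklore] -/
theorem pairKernelReg_add_period (hL : L ≠ 0) (ε δx δy : ℝ) :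
    pairKernelReg L ε (δx + L) δy = pairKernelReg L ε δx δy := by
  simp only [pairKernelReg]; rw [normFst_add_period hL, Real.cos_add_two_pi]

end Algebra

/-! ### Continuity -/

section Continuity

variable {L ε : ℝ}

/-- `kerU` is continuous for `ε > 0`. [folklore] -/
theorem continuous_kerU (hε : 0 < ε) (L : ℝ) : Continuous fun p : ℝ × ℝ => kerU L ε p.1 p.2 := by
  unfold kerU
  exact Continuous.div (by fun_prop) (by fun_prop) fun p => (denR_pos hε L p.1 p.2).ne'

/-- `kerV` is continuous for `ε > 0`. [folklore] -/
theorem continuous_kerV (hε : 0 < ε) (L : ℝ) : Continuous fun p : ℝ × ℝ => kerV L ε p.1 p.2 := by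
  unfold kerV
  exact Continuous.div (by fun_prop) (by fun_prop) fun p => (denR_pos hε L p.1 p.2).ne'

/-- `kerUU` is continuous for `ε > 0`. [folklore] -/
theorem continuous_kerUU (hε : 0 < ε) (L : ℝ) : Continuous fun p : ℝ × ℝ => kerUU L ε p.1 p.2 := by
  unfold kerUU
  exact Continuous.div (by fun_prop) (by fun_prop) fun p => pow_ne_zero 2 (denR_pos hε L p.1 p.2).ne'

/-- `kerVV` is continuous for `ε > 0`. [folklore] -/
theorem continuous_kerVV (hε : 0 < ε) (L : ℝ) : Continuous fun p : ℝ × ℝ => kerVV L ε p.1 p.2 := by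
  unfold kerVV
  exact Continuous.div (by fun_prop) (by fun_prop) fun p => pow_ne_zero 2 (denR_pos hε L p.1 p.2).ne'

/-- `kerUV` is continuous for `ε > 0`. [folklore] -/
theorem continuous_kerUV (hε : 0 < ε) (L : ℝ) : Continuous fun p : ℝ × ℝ => kerUV L ε p.1 p.2 := by
  unfold kerUV
  exact Continuous.div (by fun_prop) (by fun_prop) fun p => pow_ne_zero 2 (denR_pos hε L p.1 p.2).ne'

/-- `bump` is continuous for `ε > 0`. [folklore] -/
theorem continuous_bump (hε : 0 < ε) (L : ℝ) : Continuous fun p : ℝ × ℝ => bump L ε p.1 p.2 := by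
  unfold bump
  exact continuous_const.mul
    (Continuous.div (by fun_prop) (by fun_prop) fun p => pow_ne_zero 2 (denR_pos hε L p.1 p.2).ne')

/-- `pairKernelReg` is continuous for `ε > 0`, `L ≠ 0`. [folklore] -/
theorem continuous_pairKernelReg (hε : 0 < ε) (hL : L ≠ 0) :
    Continuous fun p : ℝ × ℝ => pairKernelReg L ε p.1 p.2 := by
  unfold pairKernelReg
  exact Continuous.div (by fun_prop) (by fun_prop) fun p =>
    mul_ne_zero (mul_ne_zero two_ne_zero hL) (denR_pos hε L p.1 p.2).ne'

/-- `pairKernelReg` is measurable (any `ε`). [folklore] -/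
theorem measurable_pairKernelReg (L ε : ℝ) : Measurable fun p : ℝ × ℝ => pairKernelReg L ε p.1 p.2 := by
  unfold pairKernelReg; fun_prop

end Continuity

/-! ### Slice derivatives in the shifted variables -/

section Deriv

variable {L ε : ℝ}

/-- `∂_{x′} K₁^ε(x − x′, y − y′) = (2π/L) kerUV(x − x′, y − y′)`. [folklore] -/
theorem hasDerivAt_kerU_fst (hε : 0 < ε) (L x y x' y' : ℝ) :
    HasDerivAt (fun s => kerU L ε (x - s) (y - y')) (2 * π / L * kerUV L ε (x - x') (y - y')) x' := by
  have hS : HasDerivAt (fun s : ℝ => 2 * π * (x - s) / L) (-(2 * π / L)) x' :=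
    ((((hasDerivAt_id' x').const_sub x).const_mul (2 * π)).div_const L).congr_deriv (by ring)
  have hD : HasDerivAt (fun s : ℝ => Real.cosh (2 * π * (y - y') / L) - Real.cos (2 * π * (x - s) / L) + ε)
      (-(-Real.sin (2 * π * (x - x') / L) * -(2 * π / L))) x' :=
    ((hS.cos.const_sub _).add_const ε)
  have h := (hasDerivAt_const x' (Real.sinh (2 * π * (y - y') / L))).fun_div hD (denR_pos hε L _ _).ne'
  simp only [kerU, kerUV]
  refine h.congr_deriv ?_
  ring

/-- `∂_{y′} K₁^ε(x − x′, y − y′) = −(2π/L) kerUU(x − x′, y − y′)`. [folklore] -/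
theorem hasDerivAt_kerU_snd (hε : 0 < ε) (L x y x' y' : ℝ) :
    HasDerivAt (fun s => kerU L ε (x - x') (y - s)) (-(2 * π / L) * kerUU L ε (x - x') (y - y')) y' := by
  have hT : HasDerivAt (fun s : ℝ => 2 * π * (y - s) / L) (-(2 * π / L)) y' :=
    ((((hasDerivAt_id' y').const_sub y).const_mul (2 * π)).div_const L).congr_deriv (by ring)
  have h := (RowBiotSavart.hasDerivAt_kerRegU_snd hε (2 * π * (x - x') / L) (2 * π * (y - y') / L)).comp y' hT
  simp only [kerU, kerUU]
  refine h.congr_deriv ?_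
  ring

/-- `∂_{y′} K₂^ε(x − x′, y − y′) = (2π/L) kerUV(x − x′, y − y′)`. [folklore] -/
theorem hasDerivAt_kerV_snd (hε : 0 < ε) (L x y x' y' : ℝ) :
    HasDerivAt (fun s => kerV L ε (x - x') (y - s)) (2 * π / L * kerUV L ε (x - x') (y - y')) y' := by
  have hT : HasDerivAt (fun s : ℝ => 2 * π * (y - s) / L) (-(2 * π / L)) y' :=
    ((((hasDerivAt_id' y').const_sub y).const_mul (2 * π)).div_const L).congr_deriv (by ring)
  have hD : HasDerivAt (fun s : ℝ => Real.cosh (2 * π * (y - s) / L) - Real.cos (2 * π * (x - x') / L) + ε)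
      (Real.sinh (2 * π * (y - y') / L) * -(2 * π / L)) y' :=
    ((hT.cosh.sub_const _).add_const ε)
  have h := (hasDerivAt_const y' (Real.sin (2 * π * (x - x') / L))).fun_div hD (denR_pos hε L _ _).ne'
  simp only [kerV, kerUV]
  refine h.congr_deriv ?_
  ring

/-- `∂_{x′} K₂^ε(x − x′, y − y′) = −(2π/L) kerVV(x − x′, y − y′)`. [folklore] -/
theorem hasDerivAt_kerV_fst (hε : 0 < ε) (L x y x' y' : ℝ) :
    HasDerivAt (fun s => kerV L ε (x - s) (y - y')) (-(2 * π / L) * kerVV L ε (x - x') (y - y')) x' := by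
  have hS : HasDerivAt (fun s : ℝ => 2 * π * (x - s) / L) (-(2 * π / L)) x' :=
    ((((hasDerivAt_id' x').const_sub x).const_mul (2 * π)).div_const L).congr_deriv (by ring)
  have h := (RowBiotSavart.hasDerivAt_kerRegV_fst hε (2 * π * (x - x') / L) (2 * π * (y - y') / L)).comp x' hS
  simp only [kerV, kerVV]
  refine h.congr_deriv ?_
  ring

end Deriv

/-! ### Bounds and limits -/

section Bounds

variable {L ε : ℝ}

/-- `|kerU| ≤ 2 + 2/ε`. [folklore] -/
theorem abs_kerU_le (hε : 0 < ε) (L δx δy : ℝ) : |kerU L ε δx δy| ≤ 2 + 2 / ε :=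
  RowBiotSavart.abs_kerRegU_le_const hε _ _

/-- `|kerV| ≤ 1/ε`. [folklore] -/
theorem abs_kerV_le (hε : 0 < ε) (L δx δy : ℝ) : |kerV L ε δx δy| ≤ 1 / ε :=
  RowBiotSavart.abs_kerRegV_le_const hε _ _

/-- `|kerUV| ≤ (2 + 2/ε)(1/ε)`. [folklore] -/
theorem abs_kerUV_le (hε : 0 < ε) (L δx δy : ℝ) : |kerUV L ε δx δy| ≤ (2 + 2 / ε) * (1 / ε) := by
  rw [kerUV_eq_mul, abs_mul]
  exact mul_le_mul (abs_kerU_le hε L δx δy) (abs_kerV_le hε L δx δy) (abs_nonneg _) (by positivity)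

/-- `|2πδy/L| = (2π/L)|δy|` for `L > 0`. [folklore] -/
theorem abs_normSnd (hL : 0 < L) (δy : ℝ) : |2 * π * δy / L| = 2 * π / L * |δy| := by
  rw [abs_div, abs_mul, abs_of_pos hL, abs_of_pos (by positivity : (0:ℝ) < 2 * π)]; ring

/-- `|kerUU| ≤ K e^{−(2π/L)|δy|}`, `K = ((2 + 2/ε) + (2 + 2/ε)² + 24) e²` (`ε ≤ 1`). [folklore] -/
theorem abs_kerUU_le (hL : 0 < L) (hε : 0 < ε) (hε1 : ε ≤ 1) (δx δy : ℝ) :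
    |kerUU L ε δx δy| ≤ ((2 + 2 / ε) + (2 + 2 / ε) ^ 2 + 24) * Real.exp 2 * Real.exp (-(2 * π / L) * |δy|) := by
  have h := RowBiotSavart.abs_kerRegU'_le_exp_all hε hε1 (2 * π * δx / L) (2 * π * δy / L)
  rw [abs_normSnd hL, ← neg_mul] at h
  exact h

/-- `|kerVV| ≤ K′ e^{−(2π/L)|δy|}`, `K′ = (1/ε + 1/ε² + 24) e²` (`ε ≤ 1`). [folklore] -/
theorem abs_kerVV_le (hL : 0 < L) (hε : 0 < ε) (hε1 : ε ≤ 1) (δx δy : ℝ) :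
    |kerVV L ε δx δy| ≤ (1 / ε + (1 / ε) ^ 2 + 24) * Real.exp 2 * Real.exp (-(2 * π / L) * |δy|) := by
  have h := RowBiotSavart.abs_kerRegV'_le_exp_all hε hε1 (2 * π * δx / L) (2 * π * δy / L)
  rw [abs_normSnd hL, ← neg_mul] at h
  exact h

/-- The flux above: `K₁^ε(x − x′, y − y′) → −1` as `y′ → +∞` (`ε ≥ 0`, `L > 0`). [folklore] -/
theorem tendsto_kerU_atTop (hL : 0 < L) (hε : 0 ≤ ε) (x x' y : ℝ) :
    Tendsto (fun y' => kerU L ε (x - x') (y - y')) atTop (𝓝 (-1)) := by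
  have h1 : Tendsto (fun y' : ℝ => 2 * π * (y - y') / L) atTop atBot := by
    have h0 : Tendsto (fun y' : ℝ => y - y') atTop atBot :=
      (tendsto_atBot_add_const_left _ y tendsto_neg_atTop_atBot).congr fun y' => (sub_eq_add_neg y y').symm
    exact (h0.const_mul_atBot (by positivity : (0:ℝ) < 2 * π)).atBot_div_const hL
  exact (RowBiotSavart.tendsto_kerRegU_atBot hε (2 * π * (x - x') / L)).comp h1

/-- The flux below: `K₁^ε(x − x′, y − y′) → 1` as `y′ → −∞`. [folklore] -/
theorem tendsto_kerU_atBot (hL : 0 < L) (hε : 0 ≤ ε) (x x' y : ℝ) :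
    Tendsto (fun y' => kerU L ε (x - x') (y - y')) atBot (𝓝 1) := by
  have h1 : Tendsto (fun y' : ℝ => 2 * π * (y - y') / L) atBot atTop := by
    have h0 : Tendsto (fun y' : ℝ => y - y') atBot atTop :=
      (tendsto_atTop_add_const_left _ y tendsto_neg_atBot_atTop).congr fun y' => (sub_eq_add_neg y y').symm
    exact (h0.const_mul_atTop (by positivity : (0:ℝ) < 2 * π)).atTop_div_const hL
  exact (RowBiotSavart.tendsto_kerRegU_atTop hε (2 * π * (x - x') / L)).comp h1

/-! ### The pair kernel has no singularity -/

/-- `r cosh r ≤ (r + 1) sinh r` for `r ≥ 0` (`cosh − sinh = e^{−r} ≤ 1`, `r ≤ sinh r`). [folklore] -/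
theorem mul_cosh_le (r : ℝ) (hr : 0 ≤ r) : r * Real.cosh r ≤ (r + 1) * Real.sinh r := by
  have h1 : Real.cosh r = Real.sinh r + Real.exp (-r) := by linarith [Real.cosh_sub_sinh r]
  have h2 : Real.exp (-r) ≤ 1 := by rw [Real.exp_le_one_iff]; linarith
  have h3 : r ≤ Real.sinh r := Real.self_le_sinh_iff.2 hr
  rw [h1]
  nlinarith [Real.exp_pos (-r)]

/-- `|t| · sinh |t| ≤ (|t| + 2)(cosh t − 1)` (half-angle formulas and `mul_cosh_le`). [folklore] -/
theorem abs_mul_sinh_abs_le (t : ℝ) : |t| * Real.sinh |t| ≤ (|t| + 2) * (Real.cosh t - 1) := by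
  set r : ℝ := |t| / 2 with hr
  have hr0 : 0 ≤ r := by positivity
  have ht : |t| = 2 * r := by rw [hr]; ring
  have hs : Real.sinh |t| = 2 * Real.sinh r * Real.cosh r := by rw [ht, Real.sinh_two_mul]
  have hc : Real.cosh t - 1 = 2 * Real.sinh r ^ 2 := by
    rw [← Real.cosh_abs, ht, Real.cosh_two_mul, Real.cosh_sq]; ring
  rw [hs, hc, ht]
  have h := mul_cosh_le r hr0
  have hsr : 0 ≤ Real.sinh r := Real.sinh_nonneg_iff.2 hr0
  nlinarith [mul_le_mul_of_nonneg_right h hsr]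

/-- **UNIFORM PAIR-KERNEL BOUND**: `|pairKernelReg L ε δx δy| ≤ |δy|/(2L) + 1/(2π)` for `ε ≥ 0`, `L > 0`.
[folklore] -/
theorem abs_pairKernelReg_le (hL : 0 < L) (hε : 0 ≤ ε) (δx δy : ℝ) :
    |pairKernelReg L ε δx δy| ≤ |δy| / (2 * L) + 1 / (2 * π) := by
  simp only [pairKernelReg]
  set t : ℝ := 2 * π * δy / L with htdef
  set s : ℝ := 2 * π * δx / L
  have hδ : δy = L / (2 * π) * t := by rw [htdef]; field_simp
  have hrhs : |δy| / (2 * L) + 1 / (2 * π) = (|t| + 2) / (4 * π) := by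
    rw [hδ, abs_mul, abs_of_pos (by positivity : (0:ℝ) < L / (2 * π))]
    field_simp
    ring
  rw [hrhs]
  rcases eq_or_lt_of_le (show (0:ℝ) ≤ Real.cosh t - 1 by linarith [Real.one_le_cosh t]) with h0 | h0
  · -- `cosh t = 1`: `t = 0`, the kernel vanishes
    have ht0 : t = 0 := by
      by_contra h
      have := Real.one_lt_cosh.2 h
      linarith
    have : δy = 0 := by rw [hδ, ht0, mul_zero]
    rw [this, zero_mul, zero_div, abs_zero]
    positivity
  · have hD : Real.cosh t - 1 ≤ Real.cosh t - Real.cos s + ε := by linarith [Real.cos_le_one s]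
    have hDpos : 0 < Real.cosh t - Real.cos s + ε := h0.trans_le hD
    have key := abs_mul_sinh_abs_le t
    rw [abs_div, abs_mul, abs_mul, abs_mul, abs_of_pos hL, abs_of_pos hDpos, abs_two, hδ, abs_mul,
      abs_of_pos (by positivity : (0:ℝ) < L / (2 * π)), Real.abs_sinh, div_le_div_iff₀ (by positivity)
      (by positivity)]
    calc L / (2 * π) * |t| * Real.sinh |t| * (4 * π) = 2 * L * (|t| * Real.sinh |t|) := by
          field_simp; ring
      _ ≤ 2 * L * ((|t| + 2) * (Real.cosh t - 1)) := mul_le_mul_of_nonneg_left key (by positivity)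
      _ ≤ 2 * L * ((|t| + 2) * (Real.cosh t - Real.cos s + ε)) :=
          mul_le_mul_of_nonneg_left (mul_le_mul_of_nonneg_left hD (by positivity)) (by positivity)
      _ = (|t| + 2) * (2 * L * (Real.cosh t - Real.cos s + ε)) := by ring

/-- The pair kernel of the line obeys the same bound. [folklore] -/
theorem abs_pairKernel_le (hL : 0 < L) (δx δy : ℝ) : |pairKernel L δx δy| ≤ |δy| / (2 * L) + 1 / (2 * π) := by
  rw [← pairKernelReg_zero]; exact abs_pairKernelReg_le hL le_rfl δx δy

end Bounds

/-- **The strain-work pair kernel has no singularity** (registered on stmt-AnomalousDissipation-3007 as the helper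
sub-goal `stub_momentPairKernel_pairKernelBound` of `stub_momentPairKernel`): for `L > 0`,
`|pairKernel L δx δy| ≤ |δy|/(2L) + 1/(2π)` for all `δx, δy` (`abs_pairKernel_le`). [folklore] -/
theorem stub_momentPairKernel_pairKernelBound :
    ∀ (L δx δy : ℝ), 0 < L → |pairKernel L δx δy| ≤ |δy| / (2 * L) + 1 / (2 * Real.pi) :=
  fun _ δx δy hL => abs_pairKernel_le hL δx δy

end Summit.AnomalousDissipation.AnomalousDissipation.Theorems.StrainedLayerLaw.StrainWorkSumRule

end
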